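import Summits.Schanuel.Schanuel.Theorems.RootDecomp1KHyper38

/-!
# RootDecomp1KHyper — lens 6, generation 15 ADDENDA (ExpAnchorT v2 88910796… §1–§6 · PiAnchorT b5ead9a0… §7 · PiAnchorU ed654c66… §8–§9) — continuation (RootDecomp1KHyper39): §8 second half (ll. 3095–3270): `hyperLatApprox_of_anchorW`, the UNIFORM theorem `sb_three_of_measuredLatAnchor` (NO named fact in the statement), `sb_three_of_measuredLatAnchor_of_latLB`

(lens-6 g15 addenda: `ExpAnchorT.lean` v2 88910796… = parts 28–35, `PiAnchorT.lean` b5ead9a0… §7 = parts 36–37, `PiAnchorU.lean` ed654c66… §8–§9 (U ll. 2881–3654; A–I byte-identical to T up to the two lint fixes) = parts 38–41;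
farm rc 0 · 0 sorry · axioms std; port by census-1 gen 14, CENSUS-REQUESTs STATUS L1561 / L1583 / L1616, critic PORT GO L1568 (e) / L1588 (e) / L1617 (e); import `RootDecomp1KHyper26` (+ the two Nesterenko Literature modules from part 36 on),
sub-namespace `…HyperCell.LatCell`; statements and proofs verbatim (docstrings added, generic one-liners privatised; lint fixes: L1588 (a)'s two in §7c and two unused simp args `Matrix.head_cons` in §8a); binders hLW / h52 / hNW BY NAME; `--supports stmt-Schanuel-33363` (residual of record n = 3 := UnanchoredResidual₃‴, critic L1617 (c)). Nothing here proves Schanuel; rung 0.)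
-/

noncomputable section

open Complex IntermediateField Polynomial

namespace Summit.Schanuel.Schanuel.Theorems.RootDecomp1KHyper

namespace HyperCell

namespace LatCell

variable {n : ℕ}
open Summit.Schanuel.Schanuel.Theorems.RootDecomp1KGeneric (HasHLPairInSpan Rank3SpanResidual
  mem_adjoin_of_mem_span cexp_mem_adjoin_of_mem_span)

/-- **EXTRACTION under a WEAK lattice bound** (proof = `hyperLatApprox_of_anchor` verbatim, Lemma L
replaced by its weak form). -/
theorem hyperLatApprox_of_anchorW {z : Fin 3 → ℂ} (hz : LinearIndependent ℚ z)
    (hH : HyperLinLiouville z) {w₁ w₂ : ℂ} (hLB : WeakLatLB w₁ w₂) {a b : Fin 3 → ℤ}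
    (ha : ∑ i, (a i : ℂ) * z i = w₁) (hb : ∑ i, (b i : ℂ) * z i = w₂) {j : Fin 3}
    (hj : cvec a b j ≠ 0) : HyperLatApprox w₁ w₂ (z j) := by
  intro m
  set Sa : ℝ := ∑ i, |(a i : ℝ)| with hSa
  set Sb : ℝ := ∑ i, |(b i : ℝ)| with hSb
  set Sc : ℝ := ∑ i, |(cvec a b i : ℝ)| with hSc
  have hSa0 : 0 ≤ Sa := Finset.sum_nonneg fun _ _ => abs_nonneg _
  have hSb0 : 0 ≤ Sb := Finset.sum_nonneg fun _ _ => abs_nonneg _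
  have hSc0 : 0 ≤ Sc := Finset.sum_nonneg fun _ _ => abs_nonneg _
  set cj : ℝ := |(cvec a b j : ℝ)| with hcj
  have hcj1 : 1 ≤ cj := by rw [hcj, ← Int.cast_abs]; exact_mod_cast Int.one_le_abs hj
  have hcj0 : 0 < cj := by linarith only [hcj1]
  set κ₂ : ℝ := 1 + Sc + Sb + Sa with hκ₂
  have hκ₂1 : 1 ≤ κ₂ := by rw [hκ₂]; linarith only [hSa0, hSb0, hSc0]
  obtain ⟨mL, hmL⟩ := exists_level_dot_ne_zeroW hz hLB ha hb hj
  obtain ⟨T₀, hT₀⟩ := exists_le_two_pow (κ₂ + cj)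
  obtain ⟨T, hT⟩ : ∃ T : ℕ, T = T₀ + mL + 1 := ⟨_, rfl⟩
  -- the small form at level m T + T
  obtain ⟨h, hh, hsmall⟩ := hH (m * T + T)
  have hC := hmL (m * T + T) (le_trans (by omega) (Nat.le_add_left T (m * T))) h hh hsmall
  set C : ℤ := ∑ i, cvec a b i * h i with hCdef
  set Sh : ℝ := ∑ i, |(h i : ℝ)| with hSh
  set W : ℝ := 1 + Sh with hW
  have hSh1 : 1 ≤ Sh := one_le_hsum hh
  have hW2 : 2 ≤ W := by rw [hW]; linarith only [hSh1]
  have hW1 : 1 ≤ W := by linarith only [hW2]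
  have hW0 : 0 < W := by linarith only [hW2]
  have hShW : Sh ≤ W := by rw [hW]; linarith only [hSh1]
  set F : ℂ := ∑ i, (h i : ℂ) * z i with hF
  have hF0 : F ≠ 0 := form_ne_zero_of_linearIndependent hz hh
  have hkey := cvec_key a b h z j
  rw [← hF, ← hCdef, ha, hb] at hkey
  set A : ℤ := cvec h b j with hA
  set B : ℤ := cvec a h j with hB
  have hCabs : 1 ≤ |(C : ℝ)| := by rw [← Int.cast_abs]; exact_mod_cast Int.one_le_abs hC
  -- the sign of C and the approximant (A' w₁ + B' w₂)/Q, Q = |C|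
  set σ : ℤ := C.sign with hσ
  have hσ1 : σ = 1 ∨ σ = -1 := by
    rcases lt_or_gt_of_ne hC with hlt | hgt
    · exact Or.inr (Int.sign_eq_neg_one_of_neg hlt)
    · exact Or.inl (Int.sign_eq_one_of_pos hgt)
  set Q : ℕ := C.natAbs with hQ
  set A' : ℤ := -(σ * A) with hA'
  set B' : ℤ := -(σ * B) with hB'
  have hQpos : 0 < Q := Int.natAbs_pos.mpr hC
  have hQposR : (0 : ℝ) < Q := by exact_mod_cast hQpos
  have hQ1 : (1 : ℝ) ≤ Q := by exact_mod_cast hQpos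
  have hQC : (Q : ℂ) ≠ 0 := by exact_mod_cast hQpos.ne'
  have hQR : (Q : ℝ) = |(C : ℝ)| := by rw [hQ, Nat.cast_natAbs, Int.cast_abs]
  have hQZ : ((Q : ℕ) : ℤ) = σ * C := by rw [hQ, hσ]; exact (Int.sign_mul_self_eq_natAbs C).symm
  have hQCx : (Q : ℂ) = (σ : ℂ) * (C : ℂ) := by exact_mod_cast hQZ
  have hσabsR : |(σ : ℝ)| = 1 := by rcases hσ1 with h1 | h1 <;> simp [h1]
  have hσnorm : ‖(σ : ℂ)‖ = 1 := by rcases hσ1 with h1 | h1 <;> simp [h1]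
  have hσ0 : (σ : ℂ) ≠ 0 := by
    intro h0; rw [h0, norm_zero] at hσnorm; exact zero_ne_one hσnorm
  have hcjC : (cvec a b j : ℂ) ≠ 0 := by exact_mod_cast hj
  -- Q z_j − (A' w₁ + B' w₂) = σ c_j F
  have hQy : (Q : ℂ) * z j - (((A' : ℤ) : ℂ) * w₁ + ((B' : ℤ) : ℂ) * w₂) =
      (σ : ℂ) * ((cvec a b j : ℂ) * F) := by
    rw [hkey, hQCx, hA', hB']; push_cast; ring
  have hdiff : z j - (((A' : ℤ) : ℂ) * w₁ + ((B' : ℤ) : ℂ) * w₂) / (Q : ℂ) =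
      (σ : ℂ) * ((cvec a b j : ℂ) * F) / (Q : ℂ) := by
    rw [← hQy]; field_simp
  have hdist : ‖z j - (((A' : ℤ) : ℂ) * w₁ + ((B' : ℤ) : ℂ) * w₂) / (Q : ℂ)‖ <
      cj * Real.exp (-(W ^ (m * T + T))) := by
    rw [hdiff, norm_div, norm_mul, norm_mul, hσnorm, one_mul, Complex.norm_natCast,
      Complex.norm_intCast, ← hcj]
    calc cj * ‖F‖ / (Q : ℝ) ≤ cj * ‖F‖ := div_le_self (by positivity) hQ1
      _ < cj * Real.exp (-(W ^ (m * T + T))) := mul_lt_mul_of_pos_left hsmall hcj0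
  have hyne : z j ≠ (((A' : ℤ) : ℂ) * w₁ + ((B' : ℤ) : ℂ) * w₂) / (Q : ℂ) := by
    intro h0
    have h1 : (σ : ℂ) * ((cvec a b j : ℂ) * F) / (Q : ℂ) = 0 := by rw [← hdiff, ← h0, sub_self]
    rw [div_eq_zero_iff] at h1
    rcases h1 with h1 | h1
    · rcases mul_eq_zero.mp h1 with h2 | h2
      · exact hσ0 h2
      · rcases mul_eq_zero.mp h2 with h3 | h3
        · exact hcjC h3
        · exact hF0 h3
    · exact hQC h1
  -- height of the approximant: 1 + Q + |A'| + |B'| ≤ κ₂ W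
  have hAle : |(A : ℝ)| ≤ Sh * Sb := abs_cvec_le h b j
  have hBle : |(B : ℝ)| ≤ Sa * Sh := abs_cvec_le a h j
  have hCle : |(C : ℝ)| ≤ Sc * Sh := by rw [hCdef]; exact abs_dot_le (cvec a b) h
  have hsize : 1 + (Q : ℝ) + |(A' : ℝ)| + |(B' : ℝ)| ≤ κ₂ * W := by
    rw [hQR, hA', hB']
    push_cast
    simp only [abs_neg, abs_mul, hσabsR, one_mul]
    have h1 : |(C : ℝ)| ≤ W * Sc := hCle.trans (by nlinarith only [hShW, hSc0])
    have h2 : |(A : ℝ)| ≤ W * Sb := hAle.trans (mul_le_mul_of_nonneg_right hShW hSb0)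
    have h3 : |(B : ℝ)| ≤ Sa * W := hBle.trans (mul_le_mul_of_nonneg_left hShW hSa0)
    rw [hκ₂]; nlinarith only [h1, h2, h3, hW1, hSa0, hSb0, hSc0]
  -- level bookkeeping: cj · exp(−W^(mT+T)) ≤ exp(−(κ₂ W)^m)
  have hT₀1 : (1 : ℝ) ≤ 2 ^ T₀ := one_le_pow₀ (by norm_num)
  have h2T : κ₂ ≤ (2 : ℝ) ^ (T₀ + mL) := by
    calc κ₂ ≤ 2 ^ T₀ := by linarith only [hT₀, hcj0]
      _ ≤ 2 ^ (T₀ + mL) := pow_le_pow_right₀ (by norm_num) (by omega)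
  have hWT : κ₂ * W ≤ W ^ T := by
    rw [hT, pow_succ]
    apply mul_le_mul_of_nonneg_right _ hW0.le
    exact h2T.trans (pow_le_pow_left₀ (by norm_num) hW2 _)
  have hWT' : cj + 1 ≤ W ^ T := by
    calc cj + 1 ≤ 2 ^ T₀ + 2 ^ T₀ := by linarith only [hT₀, hT₀1, hκ₂1]
      _ = 2 ^ (T₀ + 1) := by rw [pow_succ]; ring
      _ ≤ 2 ^ T := pow_le_pow_right₀ (by norm_num) (by omega)
      _ ≤ W ^ T := pow_le_pow_left₀ (by norm_num) hW2 _
  have hκW1 : 1 ≤ κ₂ * W := one_le_mul_of_one_le_of_one_le hκ₂1 hW1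
  have hκW0 : 0 ≤ κ₂ * W := by linarith only [hκW1]
  have hWT0 : 0 ≤ W ^ T := pow_nonneg hW0.le T
  have hmain : (κ₂ * W) ^ m + cj ≤ W ^ (m * T + T) := by
    have e : W ^ (m * T + T) = (W ^ T) ^ m * W ^ T := by
      rw [pow_add, mul_comm m T, pow_mul]
    rw [e]
    have h1 : (κ₂ * W) ^ m ≤ (W ^ T) ^ m := pow_le_pow_left₀ hκW0 hWT m
    have h2 : 1 ≤ (κ₂ * W) ^ m := one_le_pow₀ hκW1
    have h3 : (κ₂ * W) ^ m * (cj + 1) ≤ (W ^ T) ^ m * W ^ T :=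
      mul_le_mul h1 hWT' (by linarith only [hcj0]) (pow_nonneg hWT0 m)
    have h4 : cj ≤ (κ₂ * W) ^ m * cj := le_mul_of_one_le_left hcj0.le h2
    calc (κ₂ * W) ^ m + cj ≤ (κ₂ * W) ^ m + (κ₂ * W) ^ m * cj := by linarith only [h4]
      _ = (κ₂ * W) ^ m * (cj + 1) := by ring
      _ ≤ (W ^ T) ^ m * W ^ T := h3
  have hfinal : cj * Real.exp (-(W ^ (m * T + T))) ≤
      Real.exp (-((1 + (Q : ℝ) + |(A' : ℝ)| + |(B' : ℝ)|) ^ m)) := by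
    have hlog : Real.log cj ≤ cj - 1 := Real.log_le_sub_one_of_pos hcj0
    have h1 : cj * Real.exp (-(W ^ (m * T + T))) =
        Real.exp (Real.log cj + -(W ^ (m * T + T))) := by
      rw [Real.exp_add, Real.exp_log hcj0]
    rw [h1]
    apply Real.exp_le_exp.mpr
    have h0 : 0 ≤ 1 + (Q : ℝ) + |(A' : ℝ)| + |(B' : ℝ)| := by
      linarith only [hQposR, abs_nonneg (A' : ℝ), abs_nonneg (B' : ℝ)]
    have h2 : (1 + (Q : ℝ) + |(A' : ℝ)| + |(B' : ℝ)|) ^ m ≤ (κ₂ * W) ^ m :=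
      pow_le_pow_left₀ h0 hsize m
    linarith only [hlog, h2, hmain]
  exact ⟨A', B', Q, hQpos, hyne, hdist.trans_le hfinal⟩

/-- **THE UNIFORM MEASURED-LATTICE-ANCHOR THEOREM.**  Let `θ` be ANY pair with a weak simultaneous
measure (`MvWeakMeasure θ`) lying in `ℚ(z, e^z, i)`, and let `W₁(θ), W₂(θ)` be two points of `ℤ[θ]`,
polynomially independent over `ℤ` (`U W₁ + V W₂ ≠ 0` for `(U, V) ≠ 0`), both in `span_ℤ(z)`.  Then the
ℚ-free `HyperLinLiouville` triple `z` has Schanuel's bound.  ALL the anchored cells of this file are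
instances: `θ = (e^{β₁}, e^{β₂})` with LW (§1, §5, §6), `θ = (e^{π}, π)` with Nesterenko (§7, §8). -/
theorem sb_three_of_measuredLatAnchor {z : Fin 3 → ℂ} (hz : LinearIndependent ℚ z)
    (hH : HyperLinLiouville z) {θ : Fin 2 → ℂ} (hθ : MvWeakMeasure θ)
    (hθz : ∀ i, θ i ∈ adjoin ℚ (SFset z ∪ {I})) (W₁ W₂ : MvPolynomial (Fin 2) ℤ)
    (hW : ∀ U V : ℤ, (U ≠ 0 ∨ V ≠ 0) → MvPolynomial.C U * W₁ + MvPolynomial.C V * W₂ ≠ 0)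
    (h₁ : MvPolynomial.aeval θ W₁ ∈ Submodule.span ℤ (Set.range z))
    (h₂ : MvPolynomial.aeval θ W₂ ∈ Submodule.span ℤ (Set.range z)) : SB 3 z := by
  have hLB := weakLatLB_of_mvWeakMeasure hθ W₁ W₂ hW
  obtain ⟨a, ha⟩ := (Submodule.mem_span_range_iff_exists_fun ℤ).mp h₁
  obtain ⟨b, hb⟩ := (Submodule.mem_span_range_iff_exists_fun ℤ).mp h₂
  simp only [zsmul_eq_mul] at ha hb
  obtain ⟨j, hj⟩ := exists_cvec_ne_zeroW hLB ha hb
  have hy := hyperLatApprox_of_anchorW hz hH hLB ha hb hj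
  exact sb_of_hyperLat_of_mvWeakMeasure (n := 2) hθ hθz W₁ W₂ hy
    (mem_adjoin_SFset_I' (Or.inl ⟨j, rfl⟩))

/-- The polynomial-measure engine `sb_three_of_latAnchorW` is the special case of a polynomial
lattice bound (kept for the record: the uniform theorem needs no separate lattice input at all). -/
theorem sb_three_of_measuredLatAnchor_of_latLB {z : Fin 3 → ℂ} (hz : LinearIndependent ℚ z)
    (hH : HyperLinLiouville z) {θ : Fin 2 → ℂ} (hθ : MvWeakMeasure θ)
    (hθz : ∀ i, θ i ∈ adjoin ℚ (SFset z ∪ {I})) (W₁ W₂ : MvPolynomial (Fin 2) ℤ)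
    {w₁ w₂ : ℂ} (hw₁ : MvPolynomial.aeval θ W₁ = w₁) (hw₂ : MvPolynomial.aeval θ W₂ = w₂)
    (hLB : WeakLatLB w₁ w₂)
    (h₁ : w₁ ∈ Submodule.span ℤ (Set.range z)) (h₂ : w₂ ∈ Submodule.span ℤ (Set.range z)) :
    SB 3 z := by
  obtain ⟨a, ha⟩ := (Submodule.mem_span_range_iff_exists_fun ℤ).mp h₁
  obtain ⟨b, hb⟩ := (Submodule.mem_span_range_iff_exists_fun ℤ).mp h₂
  simp only [zsmul_eq_mul] at ha hb
  obtain ⟨j, hj⟩ := exists_cvec_ne_zeroW hLB ha hb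
  have hy := hyperLatApprox_of_anchorW hz hH hLB ha hb hj
  rw [← hw₁, ← hw₂] at hy
  exact sb_of_hyperLat_of_mvWeakMeasure (n := 2) hθ hθz W₁ W₂ hy
    (mem_adjoin_SFset_I' (Or.inl ⟨j, rfl⟩))

end LatCell

end HyperCell

end Summit.Schanuel.Schanuel.Theorems.RootDecomp1KHyper
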